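import Summits.FinalStateConjecture.FinalStateConjecture.Theses.CurvatureOrSymmetry

/-!
# Birth skeleton (BC3) for crux `TameCensoredDataExit` (stmt-FinalStateConjecture-17348),
# route `CurvatureOrSymmetry` — "settle first (closed), then the generic third law, then the interior"

planner-skel-stmt-FinalStateConjecture-17348-0 (skeleton registrar, route re-audit bin REPAIRABLE),
2026-08-17. Target: the route decl
`Summit.FinalStateConjecture.FinalStateConjecture.Theses.CurvatureOrSymmetry.TameCensoredDataExit`
BY NAME (rev 6 of the route file), concluded by `TameCensoredDataExit_of` from four named stubs.

## The crux

TAME CENSORED DATA EXIT (the censored half of the re-typed summit, local form; shared item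
stmt-17348, wanted by CurvatureOrSymmetry r5 / HomotheticSurfaceGravity r4 / NoVacuumStrings r5 /
TangentProfileCensorship r3): through every admissible datum `D` which has an MGHD, all of whose
MGHDs have complete `𝓘⁺`, but some MGHD of which carries no GOOD decomposition (sub-extremal Kerr
final-state decomposition `d` of `O = exteriorOf 𝒟 d.charted` with `RaysStayInClosure`,
honest-radii `HasExhaustiveCharts`, `IsFutureOriented`), passes — on one end `e` — a tame, immersed,
injective curve of admissible data whose members with `0 < ‖c‖ < ε` are GOOD.

## The line: settle (closed) ∘ third law (open) ∘ interior, chained by the landed kernel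

"Good" is the conjunction of a CLOSED condition (the MGHDs settle down to finitely many Kerr black
holes, `|aᵢ| ≤ Mᵢ` — the spin bound is structural in `FinalStateDecomposition.abs_spin_le_mass`),
an OPEN one (every final hole is SUB-extremal, `|aᵢ| < Mᵢ`: the third law is only generic —
Kehle–Unger form extremal horizons from regular data) and an INTERIOR one (`RaysStayInClosure`: no
future-complete null ray from `Σ` survives strictly inside the black holes; the vacuity audit's
Q-F1). Genericity is not closed under `∧`, so the three are produced ALONG CURVES, each stub handing
a tame curve through the SAME base datum on the SAME end to the next; the landed kernel
`InitialDataSet.exists_tameFamily_of_local` (TameGenericityLocal.lean, sorry-free: radial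
contraction of the parameter) turns "members with `0 < ‖c‖ < ε`" into "all members off `0`"
between the stubs.

* `stub_censoredCurveExit` (S1) — LOCAL WEAK-CENSORSHIP STABILITY AT CENSORED DATA: under the crux's
  hypotheses on `D`, there is a tame immersed injective admissible curve through `D` whose small
  members are CENSORED and own an MGHD. (Tame admissible curves through `D` exist at all — the
  vacuum constraint set is a manifold in the DR-weighted class, Bartnik 2005 / Chruściel–Delay 2003
  / Corvino–Schoen 2006 — and one of them misses the naked data near `D`, which weak cosmic
  censorship makes of positive codimension.) A literal weakening of the crux's conclusion.
* `stub_settlingAlongCensoredCurves` (S2, load-bearing) — CENSORED VACUUM SOLUTIONS GENERICALLY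
  SETTLE DOWN TO KERR BLACK HOLES, relative curve form: `D` censored with an MGHD; given a tame
  immersed injective admissible curve through `D` all of whose members off `0` are censored with
  MGHDs, there is one (same end, through `D`) whose small members have MGHDs each of which is
  censored and carries a final-state decomposition `d` (structural `|aᵢ| ≤ Mᵢ`, extremal holes
  ALLOWED) of `O = exteriorOf 𝒟 d.charted` with honest-radii `HasExhaustiveCharts d` and
  `IsFutureOriented d`. Large-data asymptotic stability of the Kerr family / final-state rigidity.
* `stub_thirdLawAlongSettlingCurves` (S3) — THE THIRD LAW IS GENERIC, relative curve form: `D`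
  censored with an MGHD; given a tame immersed injective admissible curve through `D` all of whose
  members off `0` settle in the sense of S2, there is one (same end, through `D`) whose small members
  settle with every final hole SUB-extremal (`Kerr.IsSubextremal`). Kehle–Unger's extremal threshold
  is left along a re-chosen curve while settling persists.
* `stub_raysStayOfHonestSettling` (S4) — THE INTERIOR CLAIM IS AUTOMATIC, pointwise: for a censored
  MGHD of an admissible datum and ANY sub-extremal decomposition `d` of `O = exteriorOf 𝒟 d.charted`
  with `HasExhaustiveCharts d` and `IsFutureOriented d`, every future-complete normalised null ray
  from `Σ` stays in `closure O` (honest charts reach down to the event horizons, so `closure O`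
  contains the domain of outer communications; and no null ray from `Σ` is future-complete strictly
  inside a black hole settling to sub-extremal Kerr — Dafermos–Luk Cauchy-horizon termination).

`crux_body_of_stub_sigs : S1-sig → S2-sig → S3-sig → S4-sig → <body of the crux>` (sorry-free,
below): S1 at `D`; kernel; S2 (base `D` censored by the crux's hypotheses); kernel; S3; then S4
pointwise inside the good clause. `TameCensoredDataExit_of : <route decl> :=
crux_body_of_stub_sigs stub_… stub_… stub_… stub_…` — the only theorem of the file whose conclusion
is the crux BY NAME, hypothesis-free (A12 shape); the file's only `sorry`s are the four stubs.

Disproof used: no `Cruxes/TameCensoredDataExit/Disproof.lean`, no `Theorems/TameCensoredDataExit/Negative/`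
exists (crux dir empty at registration); negatives index of the summit: one unrelated entry
(UniformPhotonSphereChannels). Honest-top certificate on the item (HonestTopT2.lean, rrepair
2026-08-16): `FinalStateConjecture → TameCensoredDataExit`, so no stub may be ≥ the summit — each is
strictly below it (S1–S3 are exit/handback statements at censored data only; S4 is an interior
lemma).
-/

noncomputable section

-- D-0017: single-problem summit, `Summit.<S>.<S>.…` by design (cf. lakefile `weak.linter.dupNamespace`).
set_option linter.dupNamespace false

open Set Function Filter
open scoped Manifold ContDiff Topology

namespace Summit.FinalStateConjecture.FinalStateConjecture.Cruxes.TameCensoredDataExit.Birth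

open Literature.Geometry.Lorentzian

/-! ## §1 The stubs -/

/-- **Stub 1 — local weak-censorship stability at censored data (exit into censored data).**
For every admissible datum `D` satisfying the crux's hypotheses (an MGHD exists; every MGHD has
complete `𝓘⁺`; some MGHD carries no good decomposition) there are ONE asymptotically flat end `e`
of `X`, a one-parameter family `F` of admissible data tame on `e`, immersed at `0`, injective, with
`F 0 = D`, and `ε > 0` such that for `0 < ‖c‖ < ε` the datum `F c` owns an MGHD and every MGHD of
`F c` has complete `𝓘⁺`. Content: tame admissible curves through `D` exist (the vacuum constraint
set is a Banach manifold in the weighted class: Bartnik 2005; Chruściel–Delay 2003; Corvino–Schoen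
2006) and one of them misses, near `D`, the naked data, which weak cosmic censorship
(Christodoulou, CQG 16 (1999) p. A24) makes of positive codimension. Why it might fail: naked data
may accumulate at a censored `D` along every tame curve (Cantor-like lamination of collapse
thresholds, cf. critical phenomena arXiv:0711.4612); tame curves need the constraint manifold in
the DR-weighted `C²₋₁ × C¹₋₂` class. A literal weakening of the crux (its conclusion with "good"
replaced by "censored with an MGHD"). Open. -/
theorem stub_censoredCurveExit : ∀ (X : Type) [TopologicalSpace X] [ChartedSpace E3 X] [IsManifold (𝓡 3) ((⊤ : ℕ∞) : WithTop ℕ∞) X] [T2Space X] [SecondCountableTopology X] [ConnectedSpace X], ∀ D ∈ admissibleVacuumData X, (∃ 𝒟 : VacuumCauchyDevelopment D, 𝒟.IsMaximal) → (∀ 𝒟 : VacuumCauchyDevelopment D, 𝒟.IsMaximal → Summit.FinalStateConjecture.HasCompleteNullInfinity 𝒟.toCauchyDevelopment) → (∃ 𝒟 : VacuumCauchyDevelopment D, 𝒟.IsMaximal ∧ ¬ ∃ (O : Set 𝒟.carrier) (d : FinalStateDecomposition 𝒟.toSpacetime O 2), (∀ i, Kerr.IsSubextremal (d.mass i) (d.spin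 i)) ∧ O = Summit.FinalStateConjecture.exteriorOf 𝒟.toCauchyDevelopment d.charted ∧ Summit.FinalStateConjecture.RaysStayInClosure 𝒟.toCauchyDevelopment O ∧ Summit.FinalStateConjecture.HasExhaustiveCharts d ∧ Summit.FinalStateConjecture.IsFutureOriented d) → ∃ (e : AFEnd X) (F : EuclideanSpace ℝ (Fin 1) → InitialDataSet (𝓡 3) X), InitialDataSet.IsTameDataFamily e 1 F ∧ InitialDataSet.IsImmersedAtZero 1 F ∧ F 0 = D ∧ Function.Injective F ∧ (∀ c, F c ∈ admissibleVacuumData X) ∧ ∃ ε : ℝ, 0 < ε ∧ ∀ c, c ≠ 0 → ‖c‖ < ε → ((∃ 𝒟 : VacuumCauchyDevelopment (F c), 𝒟.IsMaximal) ∧ ∀ 𝒟 : VacuumCauchyDevelopment (F c), 𝒟.IsMaximal → Summit.FinalStateConjecture.HasCompleteNullInfinity 𝒟.toCauchyDevelopment) := by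
  sorry

/-- **Stub 2 — censored vacuum solutions generically settle down to Kerr black holes (relative
curve form; the load-bearing stub).** Let `D` be an admissible datum owning an MGHD, all of whose
MGHDs have complete `𝓘⁺`, and let `F` be a one-parameter family of admissible data, tame on the end
`e`, immersed at `0`, injective, `F 0 = D`, ALL of whose members off `0` are censored with an MGHD.
Then there is a family `F'` of admissible data, tame on the SAME end, immersed at `0`, injective,
`F' 0 = D`, and `ε > 0` such that for `0 < ‖c‖ < ε`: `F' c` owns an MGHD, and every MGHD of `F' c`
has complete `𝓘⁺` and carries a final-state decomposition `d` — finitely many boosted Kerr black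
holes with the structural bound `|aᵢ| ≤ Mᵢ` (EXTREMAL HOLES ALLOWED), `N = 0` dispersal — of its
self-determined exterior `O = exteriorOf 𝒟 d.charted` with honest radii (`HasExhaustiveCharts d`)
and future-oriented chart time (`IsFutureOriented d`). This is large-data asymptotic stability of
the Kerr family for censored developments (Dafermos–Luk arXiv:1710.01722 §1.2.1; Klainerman–Szeftel
PAMQ 19 (2023) for `|a| ≪ M`; Giorgi–Klainerman–Szeftel arXiv:2205.14808; Dafermos–Holzegel–
Rodnianski–Taylor arXiv:2104.08222), produced along censorship curves. Why it might fail: Kerr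
stability is printed only for `|a| ≪ M` (barrier `SlowlyRotatingKerrFrontier`); an open set of
censored non-settling vacuum dynamics (bound clusters that never recede, infinitely many holes,
hair — `HairyKerrBifurcation` is Klein–Gordon, not vacuum) is excluded by no theorem; honest
`C²`-exhaustive charts need quantitative (Price-law, barrier `PriceLawTail`) decay down to the
event horizons. Open. -/
theorem stub_settlingAlongCensoredCurves : ∀ (X : Type) [TopologicalSpace X] [ChartedSpace E3 X] [IsManifold (𝓡 3) ((⊤ : ℕ∞) : WithTop ℕ∞) X] [T2Space X] [SecondCountableTopology X] [ConnectedSpace X], ∀ D ∈ admissibleVacuumData X, (∃ 𝒟 : VacuumCauchyDevelopment D, 𝒟.IsMaximal) → (∀ 𝒟 : VacuumCauchyDevelopment D, 𝒟.IsMaximal → Summit.FinalStateConjecture.HasCompleteNullInfinity 𝒟.toCauchyDevelopment) → ∀ (e : AFEnd X) (F : EuclideanSpace ℝ (Fin 1) → InitialDataSet (𝓡 3) X), InitialDataSet.IsTameDataFamily e 1 F → InitialDataSet.IsImmersedAtZero 1 F → F 0 = D → Function.Injective F → (∀ c, F c ∈ admissibleVacuumData X) → (∀ c, c ≠ 0 →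 ((∃ 𝒟 : VacuumCauchyDevelopment (F c), 𝒟.IsMaximal) ∧ ∀ 𝒟 : VacuumCauchyDevelopment (F c), 𝒟.IsMaximal → Summit.FinalStateConjecture.HasCompleteNullInfinity 𝒟.toCauchyDevelopment)) → ∃ F' : EuclideanSpace ℝ (Fin 1) → InitialDataSet (𝓡 3) X, InitialDataSet.IsTameDataFamily e 1 F' ∧ InitialDataSet.IsImmersedAtZero 1 F' ∧ F' 0 = D ∧ Function.Injective F' ∧ (∀ c, F' c ∈ admissibleVacuumData X) ∧ ∃ ε : ℝ, 0 < ε ∧ ∀ c, c ≠ 0 → ‖c‖ < ε → ((∃ 𝒟 : VacuumCauchyDevelopment (F' c), 𝒟.IsMaximal) ∧ ∀ 𝒟 : VacuumCauchyDevelopment (F' c), 𝒟.IsMaximal → Summit.FinalStateConjecture.HasCompleteNullInfinity 𝒟.toCauchyDevelopment ∧ ∃ (O : Set 𝒟.carrier) (d : FinalStateDecomposition 𝒟.toSpacetime O 2), O = Summit.FinalStateConjecture.exteriorOf 𝒟.toCauchyDevelopment d.charted ∧ Summit.FinalStateConjecture.HasExhaustiveCharts d ∧ Summit.FinalStateConjecture.IsFutureOriented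 d) := by
  sorry

/-- **Stub 3 — the third law of black-hole mechanics is generic (relative curve form).** Let `D`
be an admissible datum owning an MGHD, all of whose MGHDs have complete `𝓘⁺`, and let `F` be a
one-parameter family of admissible data, tame on `e`, immersed at `0`, injective, `F 0 = D`, all of
whose members off `0` SETTLE in the sense of Stub 2 (extremal final holes allowed). Then there is a
family `F'` of admissible data, tame on the SAME end, immersed at `0`, injective, `F' 0 = D`, and
`ε > 0` such that for `0 < ‖c‖ < ε` the datum `F' c` settles with EVERY FINAL HOLE SUB-EXTREMAL
(`Kerr.IsSubextremal (d.mass i) (d.spin i)`, i.e. `|aᵢ| < Mᵢ`). Content: extremal Kerr horizons do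
form from regular one-ended data (Kehle–Unger arXiv:2402.10190; arXiv:2211.15742 — Israel's third
law fails), but as a THRESHOLD (critical) phenomenon of positive codimension, so the extremal
members of a settling curve are met transversally and can be left along a re-chosen tame curve
through `D` while settling persists. Why it might fail: positive codimension of extremal vacuum
collapse is conjectural (KU §1.4); the re-chosen direction must keep settling (openness of settling
near the given curve); asymptotically extremal, `C²`-quiet horizons (Aretakis instability, barrier
`AretakisInstability`; Gajic arXiv:2302.06636) could make the extremal members accumulate at `D`.
Open. -/
theorem stub_thirdLawAlongSettlingCurves : ∀ (X : Type) [TopologicalSpace X] [ChartedSpace E3 X] [IsManifold (𝓡 3) ((⊤ : ℕ∞) : WithTop ℕ∞) X] [T2Space X] [SecondCountableTopology X] [ConnectedSpace X], ∀ D ∈ admissibleVacuumData X, (∃ 𝒟 : VacuumCauchyDevelopment D, 𝒟.IsMaximal) → (∀ 𝒟 : VacuumCauchyDevelopment D, 𝒟.IsMaximal → Summit.FinalStateConjecture.HasCompleteNullInfinity 𝒟.toCauchyDevelopment) → ∀ (e : AFEnd X) (F : EuclideanSpace ℝ (Fin 1) → InitialDataSet (𝓡 3) X), InitialDataSet.IsTameDataFamily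 e 1 F → InitialDataSet.IsImmersedAtZero 1 F → F 0 = D → Function.Injective F → (∀ c, F c ∈ admissibleVacuumData X) → (∀ c, c ≠ 0 → ((∃ 𝒟 : VacuumCauchyDevelopment (F c), 𝒟.IsMaximal) ∧ ∀ 𝒟 : VacuumCauchyDevelopment (F c), 𝒟.IsMaximal → Summit.FinalStateConjecture.HasCompleteNullInfinity 𝒟.toCauchyDevelopment ∧ ∃ (O : Set 𝒟.carrier) (d : FinalStateDecomposition 𝒟.toSpacetime O 2), O = Summit.FinalStateConjecture.exteriorOf 𝒟.toCauchyDevelopment d.charted ∧ Summit.FinalStateConjecture.HasExhaustiveCharts d ∧ Summit.FinalStateConjecture.IsFutureOriented d)) → ∃ F' : EuclideanSpace ℝ (Fin 1) → InitialDataSet (𝓡 3) X, InitialDataSet.IsTameDataFamily e 1 F' ∧ InitialDataSet.IsImmersedAtZero 1 F' ∧ F' 0 = D ∧ Function.Injective F' ∧ (∀ c, F' c ∈ admissibleVacuumData X) ∧ ∃ ε : ℝ, 0 < ε ∧ ∀ c, c ≠ 0 → ‖c‖ < ε → ((∃ 𝒟 : VacuumCauchyDevelopment (F' c), 𝒟.IsMaximal)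 ∧ ∀ 𝒟 : VacuumCauchyDevelopment (F' c), 𝒟.IsMaximal → Summit.FinalStateConjecture.HasCompleteNullInfinity 𝒟.toCauchyDevelopment ∧ ∃ (O : Set 𝒟.carrier) (d : FinalStateDecomposition 𝒟.toSpacetime O 2), (∀ i, Kerr.IsSubextremal (d.mass i) (d.spin i)) ∧ O = Summit.FinalStateConjecture.exteriorOf 𝒟.toCauchyDevelopment d.charted ∧ Summit.FinalStateConjecture.HasExhaustiveCharts d ∧ Summit.FinalStateConjecture.IsFutureOriented d) := by
  sorry

/-- **Stub 4 — the interior clause is automatic for honest sub-extremal settling (pointwise).**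
For an admissible datum `D`, a maximal vacuum Cauchy development `𝒟` of `D` with complete `𝓘⁺`, and
ANY `C²` final-state decomposition `d` of `O = exteriorOf 𝒟 d.charted` with every final hole
sub-extremal, honest radii (`HasExhaustiveCharts d`) and future-oriented chart time
(`IsFutureOriented d`): every future-complete normalised null ray from the data hypersurface stays
in `closure O` (`RaysStayInClosure 𝒟 O`). Two contents: (i) chart rigidity — honest, exhaustive
hole charts reach down to the event horizons and the flat chart out to `𝓘⁺`, so `closure O`
contains the domain of outer communications `J⁻(𝓘⁺) ∩ J⁺(Σ)` (the semantic-vacuity audit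
2026-08-16 §2.1 C: "could not be shrunk below the d.o.c., but only via unstated rigidity"); (ii)
interior termination — no null ray from `Σ` is future-COMPLETE strictly inside a black hole whose
exterior settles to sub-extremal Kerr: it reaches the Cauchy horizon / the singular boundary of the
MGHD at finite affine parameter (Dafermos–Luk arXiv:1710.01722, Thm. 1, `C⁰`-stability of the Kerr
Cauchy horizon; exact Kerr: O'Neill 1995). Why it might fail: a large-data black-hole interior far
from Kerr at early times could imprison a complete null geodesic (no theorem on interiors in the
large); a perverse but exhaustive decomposition with `O` smaller than the d.o.c. would refute (i) as
typed. The audit's Q-F1 "mild interior claim", isolated. Open (L). -/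
theorem stub_raysStayOfHonestSettling : ∀ (X : Type) [TopologicalSpace X] [ChartedSpace E3 X] [IsManifold (𝓡 3) ((⊤ : ℕ∞) : WithTop ℕ∞) X] [T2Space X] [SecondCountableTopology X] [ConnectedSpace X], ∀ D ∈ admissibleVacuumData X, ∀ 𝒟 : VacuumCauchyDevelopment D, 𝒟.IsMaximal → Summit.FinalStateConjecture.HasCompleteNullInfinity 𝒟.toCauchyDevelopment → ∀ (O : Set 𝒟.carrier) (d : FinalStateDecomposition 𝒟.toSpacetime O 2), (∀ i, Kerr.IsSubextremal (d.mass i) (d.spin i)) → O = Summit.FinalStateConjecture.exteriorOf 𝒟.toCauchyDevelopment d.charted → Summit.FinalStateConjecture.HasExhaustiveCharts d → Summit.FinalStateConjecture.IsFutureOriented d → Summit.FinalStateConjecture.RaysStayInClosure 𝒟.toCauchyDevelopment O := by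
  sorry

/-! ## §2 The composition (sorry-free): stubs 1–4 ⟹ the route decl, by name -/

/-- **The four stub SIGNATURES imply the body of the crux** (hypotheses = the stub statements
verbatim, conclusion = the body of the route decl `TameCensoredDataExit` verbatim — stated on the
body so that exactly ONE theorem of this file, `TameCensoredDataExit_of`, concludes the crux by name).
Proof: S1 at `D`; the kernel `InitialDataSet.exists_tameFamily_of_local` makes ALL members off `0`
censored (same end, same base datum); S2 hands back a settling curve through `D`; the kernel again;
S3 hands back a sub-extremally settling curve through `D` with an `ε`; inside its good clause S4
supplies `RaysStayInClosure` MGHD by MGHD. -/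
theorem crux_body_of_stub_sigs :
    (∀ (X : Type) [TopologicalSpace X] [ChartedSpace E3 X] [IsManifold (𝓡 3) ((⊤ : ℕ∞) : WithTop ℕ∞) X] [T2Space X] [SecondCountableTopology X] [ConnectedSpace X], ∀ D ∈ admissibleVacuumData X, (∃ 𝒟 : VacuumCauchyDevelopment D, 𝒟.IsMaximal) → (∀ 𝒟 : VacuumCauchyDevelopment D, 𝒟.IsMaximal → Summit.FinalStateConjecture.HasCompleteNullInfinity 𝒟.toCauchyDevelopment) → (∃ 𝒟 : VacuumCauchyDevelopment D, 𝒟.IsMaximal ∧ ¬ ∃ (O : Set 𝒟.carrier) (d : FinalStateDecomposition 𝒟.toSpacetime O 2), (∀ i, Kerr.IsSubextremal (d.mass i) (d.spin i)) ∧ O = Summit.FinalStateConjecture.exteriorOf 𝒟.toCauchyDevelopment d.charted ∧ Summit.FinalStateConjecture.RaysStayInClosure 𝒟.toCauchyDevelopment O ∧ Summit.FinalStateConjecture.HasExhaustiveCharts d ∧ Summit.FinalStateConjecture.IsFutureOriented d) → ∃ (e : AFEnd X) (F : EuclideanSpace ℝ (Fin 1) → InitialDataSet (𝓡 3) X), InitialDataSet.IsTameDataFamily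 e 1 F ∧ InitialDataSet.IsImmersedAtZero 1 F ∧ F 0 = D ∧ Function.Injective F ∧ (∀ c, F c ∈ admissibleVacuumData X) ∧ ∃ ε : ℝ, 0 < ε ∧ ∀ c, c ≠ 0 → ‖c‖ < ε → ((∃ 𝒟 : VacuumCauchyDevelopment (F c), 𝒟.IsMaximal) ∧ ∀ 𝒟 : VacuumCauchyDevelopment (F c), 𝒟.IsMaximal → Summit.FinalStateConjecture.HasCompleteNullInfinity 𝒟.toCauchyDevelopment)) →
    (∀ (X : Type) [TopologicalSpace X] [ChartedSpace E3 X] [IsManifold (𝓡 3) ((⊤ : ℕ∞) : WithTop ℕ∞) X] [T2Space X] [SecondCountableTopology X] [ConnectedSpace X], ∀ D ∈ admissibleVacuumData X, (∃ 𝒟 : VacuumCauchyDevelopment D, 𝒟.IsMaximal) → (∀ 𝒟 : VacuumCauchyDevelopment D, 𝒟.IsMaximal → Summit.FinalStateConjecture.HasCompleteNullInfinity 𝒟.toCauchyDevelopment) → ∀ (e : AFEnd X) (F : EuclideanSpace ℝ (Fin 1) → InitialDataSet (𝓡 3) X), InitialDataSet.IsTameDataFamily e 1 F → InitialDataSet.IsImmersedAtZero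 1 F → F 0 = D → Function.Injective F → (∀ c, F c ∈ admissibleVacuumData X) → (∀ c, c ≠ 0 → ((∃ 𝒟 : VacuumCauchyDevelopment (F c), 𝒟.IsMaximal) ∧ ∀ 𝒟 : VacuumCauchyDevelopment (F c), 𝒟.IsMaximal → Summit.FinalStateConjecture.HasCompleteNullInfinity 𝒟.toCauchyDevelopment)) → ∃ F' : EuclideanSpace ℝ (Fin 1) → InitialDataSet (𝓡 3) X, InitialDataSet.IsTameDataFamily e 1 F' ∧ InitialDataSet.IsImmersedAtZero 1 F' ∧ F' 0 = D ∧ Function.Injective F' ∧ (∀ c, F' c ∈ admissibleVacuumData X) ∧ ∃ ε : ℝ, 0 < ε ∧ ∀ c, c ≠ 0 → ‖c‖ < ε → ((∃ 𝒟 : VacuumCauchyDevelopment (F' c), 𝒟.IsMaximal) ∧ ∀ 𝒟 : VacuumCauchyDevelopment (F' c), 𝒟.IsMaximal → Summit.FinalStateConjecture.HasCompleteNullInfinity 𝒟.toCauchyDevelopment ∧ ∃ (O : Set 𝒟.carrier) (d : FinalStateDecomposition 𝒟.toSpacetime O 2), O = Summit.FinalStateConjecture.exteriorOf 𝒟.toCauchyDevelopment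 d.charted ∧ Summit.FinalStateConjecture.HasExhaustiveCharts d ∧ Summit.FinalStateConjecture.IsFutureOriented d)) →
    (∀ (X : Type) [TopologicalSpace X] [ChartedSpace E3 X] [IsManifold (𝓡 3) ((⊤ : ℕ∞) : WithTop ℕ∞) X] [T2Space X] [SecondCountableTopology X] [ConnectedSpace X], ∀ D ∈ admissibleVacuumData X, (∃ 𝒟 : VacuumCauchyDevelopment D, 𝒟.IsMaximal) → (∀ 𝒟 : VacuumCauchyDevelopment D, 𝒟.IsMaximal → Summit.FinalStateConjecture.HasCompleteNullInfinity 𝒟.toCauchyDevelopment) → ∀ (e : AFEnd X) (F : EuclideanSpace ℝ (Fin 1) → InitialDataSet (𝓡 3) X), InitialDataSet.IsTameDataFamily e 1 F → InitialDataSet.IsImmersedAtZero 1 F → F 0 = D → Function.Injective F → (∀ c, F c ∈ admissibleVacuumData X) → (∀ c, c ≠ 0 → ((∃ 𝒟 : VacuumCauchyDevelopment (F c), 𝒟.IsMaximal) ∧ ∀ 𝒟 : VacuumCauchyDevelopment (F c), 𝒟.IsMaximal → Summit.FinalStateConjecture.HasCompleteNullInfinity 𝒟.toCauchyDevelopment ∧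 ∃ (O : Set 𝒟.carrier) (d : FinalStateDecomposition 𝒟.toSpacetime O 2), O = Summit.FinalStateConjecture.exteriorOf 𝒟.toCauchyDevelopment d.charted ∧ Summit.FinalStateConjecture.HasExhaustiveCharts d ∧ Summit.FinalStateConjecture.IsFutureOriented d)) → ∃ F' : EuclideanSpace ℝ (Fin 1) → InitialDataSet (𝓡 3) X, InitialDataSet.IsTameDataFamily e 1 F' ∧ InitialDataSet.IsImmersedAtZero 1 F' ∧ F' 0 = D ∧ Function.Injective F' ∧ (∀ c, F' c ∈ admissibleVacuumData X) ∧ ∃ ε : ℝ, 0 < ε ∧ ∀ c, c ≠ 0 → ‖c‖ < ε → ((∃ 𝒟 : VacuumCauchyDevelopment (F' c), 𝒟.IsMaximal) ∧ ∀ 𝒟 : VacuumCauchyDevelopment (F' c), 𝒟.IsMaximal → Summit.FinalStateConjecture.HasCompleteNullInfinity 𝒟.toCauchyDevelopment ∧ ∃ (O : Set 𝒟.carrier) (d : FinalStateDecomposition 𝒟.toSpacetime O 2), (∀ i, Kerr.IsSubextremal (d.mass i) (d.spin i)) ∧ O = Summit.FinalStateConjecture.exteriorOf 𝒟.toCauchyDevelopment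 d.charted ∧ Summit.FinalStateConjecture.HasExhaustiveCharts d ∧ Summit.FinalStateConjecture.IsFutureOriented d)) →
    (∀ (X : Type) [TopologicalSpace X] [ChartedSpace E3 X] [IsManifold (𝓡 3) ((⊤ : ℕ∞) : WithTop ℕ∞) X] [T2Space X] [SecondCountableTopology X] [ConnectedSpace X], ∀ D ∈ admissibleVacuumData X, ∀ 𝒟 : VacuumCauchyDevelopment D, 𝒟.IsMaximal → Summit.FinalStateConjecture.HasCompleteNullInfinity 𝒟.toCauchyDevelopment → ∀ (O : Set 𝒟.carrier) (d : FinalStateDecomposition 𝒟.toSpacetime O 2), (∀ i, Kerr.IsSubextremal (d.mass i) (d.spin i)) → O = Summit.FinalStateConjecture.exteriorOf 𝒟.toCauchyDevelopment d.charted → Summit.FinalStateConjecture.HasExhaustiveCharts d → Summit.FinalStateConjecture.IsFutureOriented d → Summit.FinalStateConjecture.RaysStayInClosure 𝒟.toCauchyDevelopment O) →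
    ∀ (X : Type) [TopologicalSpace X] [ChartedSpace Literature.Geometry.Lorentzian.E3 X] [IsManifold (𝓡 3) ((⊤ : ℕ∞) : WithTop ℕ∞) X] [T2Space X] [SecondCountableTopology X] [ConnectedSpace X], ∀ D ∈ Literature.Geometry.Lorentzian.admissibleVacuumData X, (∃ 𝒟 : Literature.Geometry.Lorentzian.VacuumCauchyDevelopment D, 𝒟.IsMaximal) → (∀ 𝒟 : Literature.Geometry.Lorentzian.VacuumCauchyDevelopment D, 𝒟.IsMaximal → Summit.FinalStateConjecture.HasCompleteNullInfinity 𝒟.toCauchyDevelopment) → (∃ 𝒟 : Literature.Geometry.Lorentzian.VacuumCauchyDevelopment D, 𝒟.IsMaximal ∧ ¬ ∃ (O : Set 𝒟.carrier) (d : Literature.Geometry.Lorentzian.FinalStateDecomposition 𝒟.toSpacetime O 2), (∀ i, Literature.Geometry.Lorentzian.Kerr.IsSubextremal (d.mass i) (d.spin i)) ∧ O = Summit.FinalStateConjecture.exteriorOf 𝒟.toCauchyDevelopment d.charted ∧ Summit.FinalStateConjecture.RaysStayInClosure 𝒟.toCauchyDevelopment O ∧ Summit.FinalStateConjecture.HasExhaustiveCharts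 d ∧ Summit.FinalStateConjecture.IsFutureOriented d) → ∃ (e : Literature.Geometry.Lorentzian.AFEnd X) (F : EuclideanSpace ℝ (Fin 1) → Literature.Geometry.Lorentzian.InitialDataSet (𝓡 3) X), Literature.Geometry.Lorentzian.InitialDataSet.IsTameDataFamily e 1 F ∧ Literature.Geometry.Lorentzian.InitialDataSet.IsImmersedAtZero 1 F ∧ F 0 = D ∧ Function.Injective F ∧ (∀ c, F c ∈ Literature.Geometry.Lorentzian.admissibleVacuumData X) ∧ ∃ ε : ℝ, 0 < ε ∧ ∀ c, c ≠ 0 → ‖c‖ < ε → ((∃ 𝒟 : Literature.Geometry.Lorentzian.VacuumCauchyDevelopment (F c), 𝒟.IsMaximal) ∧ ∀ 𝒟 : Literature.Geometry.Lorentzian.VacuumCauchyDevelopment (F c), 𝒟.IsMaximal → Summit.FinalStateConjecture.HasCompleteNullInfinity 𝒟.toCauchyDevelopment ∧ ∃ (O : Set 𝒟.carrier) (d : Literature.Geometry.Lorentzian.FinalStateDecomposition 𝒟.toSpacetime O 2), (∀ i, Literature.Geometry.Lorentzian.Kerr.IsSubextremal (d.mass i) (d.spin i)) ∧ O = Summit.FinalStateConjecture.exteriorOf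 𝒟.toCauchyDevelopment d.charted ∧ Summit.FinalStateConjecture.RaysStayInClosure 𝒟.toCauchyDevelopment O ∧ Summit.FinalStateConjecture.HasExhaustiveCharts d ∧ Summit.FinalStateConjecture.IsFutureOriented d) := by
  intro h₁ h₂ h₃ h₄ X _ _ _ _ _ _ D hD H1 H2 H3
  -- S1: a tame immersed injective admissible curve through `D` whose small members are censored
  obtain ⟨e, F, hF, hI, hF0, hinj, hadm, ε, hε, hC⟩ := h₁ X D hD H1 H2 H3
  -- kernel: all members off `0` censored (same end, same base datum)
  obtain ⟨F₁, hF₁, hF₁0, hinj₁, hI₁, hadm₁, hC₁⟩ :=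
    InitialDataSet.exists_tameFamily_of_local (P := fun D' ↦
      (∃ 𝒟 : VacuumCauchyDevelopment D', 𝒟.IsMaximal) ∧ ∀ 𝒟 : VacuumCauchyDevelopment D',
        𝒟.IsMaximal → Summit.FinalStateConjecture.HasCompleteNullInfinity 𝒟.toCauchyDevelopment) hF hI hinj hadm hε hC
  -- S2: settling (closed form) along a re-chosen curve through `D`
  obtain ⟨F₂, hF₂, hI₂, hF₂0, hinj₂, hadm₂, ε₂, hε₂, hS₂⟩ :=
    h₂ X D hD H1 H2 e F₁ hF₁ hI₁ (hF₁0.trans hF0) hinj₁ hadm₁ hC₁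
  -- kernel: all members off `0` settle
  obtain ⟨F₃, hF₃, hF₃0, hinj₃, hI₃, hadm₃, hS₃⟩ :=
    InitialDataSet.exists_tameFamily_of_local (P := fun D' ↦
      (∃ 𝒟 : VacuumCauchyDevelopment D', 𝒟.IsMaximal) ∧ ∀ 𝒟 : VacuumCauchyDevelopment D',
        𝒟.IsMaximal → Summit.FinalStateConjecture.HasCompleteNullInfinity 𝒟.toCauchyDevelopment ∧
          ∃ (O : Set 𝒟.carrier) (d : FinalStateDecomposition 𝒟.toSpacetime O 2),
            O = Summit.FinalStateConjecture.exteriorOf 𝒟.toCauchyDevelopment d.charted ∧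
              Summit.FinalStateConjecture.HasExhaustiveCharts d ∧
                Summit.FinalStateConjecture.IsFutureOriented d) hF₂ hI₂ hinj₂ hadm₂ hε₂ hS₂
  -- S3: sub-extremal settling along a re-chosen curve through `D`, locally in the parameter
  obtain ⟨F₄, hF₄, hI₄, hF₄0, hinj₄, hadm₄, ε₄, hε₄, hS₄⟩ :=
    h₃ X D hD H1 H2 e F₃ hF₃ hI₃ (hF₃0.trans hF₂0) hinj₃ hadm₃ hS₃
  refine ⟨e, F₄, hF₄, hI₄, hF₄0, hinj₄, hadm₄, ε₄, hε₄, fun c hc hcε ↦ ?_⟩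
  obtain ⟨hex, hall⟩ := hS₄ c hc hcε
  refine ⟨hex, fun 𝒟 h𝒟 ↦ ?_⟩
  obtain ⟨hcni, O, d, hsub, hO, hexh, hfut⟩ := hall 𝒟 h𝒟
  -- S4: the interior clause, pointwise
  exact ⟨hcni, O, d, hsub, hO, h₄ X (F₄ c) (hadm₄ c) 𝒟 h𝒟 hcni O d hsub hO hexh hfut, hexh, hfut⟩

/-- **THE SKELETON THEOREM: `TameCensoredDataExit` (the route decl, BY NAME) from the four
registered stubs** — `crux_body_of_stub_sigs` applied to `stub_censoredCurveExit`,
`stub_settlingAlongCensoredCurves`, `stub_thirdLawAlongSettlingCurves`,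
`stub_raysStayOfHonestSettling` (the only `sorry`s of the file live inside those four stubs; this
theorem's term is sorry-free and its type is literally the route decl, which unfolds to the lemma's
conclusion by `δ`). -/
theorem TameCensoredDataExit_of :
    Summit.FinalStateConjecture.FinalStateConjecture.Theses.CurvatureOrSymmetry.TameCensoredDataExit :=
  crux_body_of_stub_sigs stub_censoredCurveExit stub_settlingAlongCensoredCurves
    stub_thirdLawAlongSettlingCurves stub_raysStayOfHonestSettling

end Summit.FinalStateConjecture.FinalStateConjecture.Cruxes.TameCensoredDataExit.Birth

end
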